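import Mathlib.LinearAlgebra.Matrix.Determinant.Basic
import Summits.ValiantsHypothesis.ValiantsHypothesis.Theorems.MatrixDescartes.Negative.MatrixDescartesFalseOfTropicalMonster

/-!
# Route «KPlusLogSqLaw», crux `TropicalB` (stmt-ValiantsHypothesis-19771) — the ALTERNATING LINE-SUM RULE (every format `m ≥ 3`)

HONEST FRAMING.  Helper file of the object-search cell `pub-symmetroid` (seat val-sym-trop-p3 g7, 2026-08-27) toward the registered
stubs `stub_tropThin` / `stub_tropFat` (each ⟺ the crux) of `Cruxes/TropicalB/Lines/birth.lean`, crux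
`Summit.ValiantsHypothesis.ValiantsHypothesis.Theses.KPlusLogSqLaw.TropicalB` (ledger item `stmt-ValiantsHypothesis-19771`, route
`KPlusLogSqLaw`); landed `--supports`, it closes nothing.  A STRUCTURAL IDENTITY about the cell's dominance designs
(`MatrixDescartes.Negative.tropWeight` / `termSign` / `IsDominant`) valid for EVERY format `(m, K)` with `m ≥ 3`; it is the typed form of
the «SUM RULE Σ rows = Σ columns» of the `m = 3` row analysis (val-sym-trop-p3 g6, FINDINGS §2, where it was an axiom of a located model,
validated numerically) — asked for as a typed lemma by the desk (R1932).  Nothing here bears on `TropicalB` in its window, on `WeakLifting` /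
`Lifting`, on DoorA26 / DoorA34, on `MatrixDescartes` (stmt-ValiantsHypothesis-18050) or on VP ≠ VNP.

THE RULE.  Fix a slope `θ` and give EVERY cell `(a, b)` of an `m × m` design a class `Λ a b` (a «cell-class map»); the Leibniz term of a
permutation `σ` read through `Λ` is `(σ, fun b ↦ Λ (σ b) b)`, of weight `W σ = Σ_b g (σ b) b` with the cell score `g a b = θ·d(Λ a b) − v a b (Λ a b)`.
* `sum_sign_mul_tropWeight_eq_zero` — for `m ≥ 3`:  `Σ_σ sign σ · W σ = 0`.  Proof: `Σ_σ sign σ · Σ_b g (σ b) b = Σ_b det M_b` where `M_b` has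
  column `b` equal to `g · b` and every other column all ones; for `m ≥ 3` two of the all-ones columns coincide, so each `det M_b = 0`
  (`Matrix.det_zero_of_column_eq`).  (For `m = 2` the rule is false: `W id − W swap` is the exchange value of the `2 × 2` square.)
* `sum_tropWeight_sign_eq` — hence the terms of sign-`s` permutations and of sign-`−s` permutations have the SAME total weight.  For `m = 3`
  the three even permutations are the lineage's «rows» `R_i = {(b+i, b)}` and the three odd ones its «columns» `C_j = {(j−b, b)}`, each
  cell lying on exactly one of each; with `Λ` = the best present class of each cell at `θ`, `W` is the line value and the rule reads
  `R₀ + R₁ + R₂ = C₀ + C₁ + C₂` (g6's SUM RULE, verbatim).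
* HALL FORM `not_forall_lt_of_signClass_equiv`, `eq_of_forall_le_of_signClass_equiv` — for any bijection `e` from the sign-`s` permutations
  to the sign-`−s` permutations it is impossible that every `σ` strictly beats its partner `e σ`; and if every `σ` weakly beats its partner
  then all these comparisons are ties.  («The domination digraph between the two sign classes has no perfect matching.»)
* AT A DOMINANT TERM `exists_ne_le_partner_of_isDominant` — if `(σ₀, μ₀)` is the unique optimum at `θ`, `Λ` extends `μ₀` on `σ₀`'s cells and
  the `Λ`-terms of the opposite sign class are present, then for every such bijection `e` some permutation `σ ≠ σ₀` OF `σ₀`'S OWN SIGN CLASS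
  does not beat its partner: `W σ ≤ W (e σ)`.  For `m = 3`: «when a row is on top, however the other two rows are paired with two columns,
  one of them loses» — the form used by the lineage's three-axiom model.
[folklore: a determinant with two equal columns vanishes; the packaging for dominance designs is the cell's]
-/

-- `Summit.ValiantsHypothesis.ValiantsHypothesis.…` repeats a component by the D-0017 layout
-- (single-conjunct summit), which the `dupNamespace` linter flags; the name is mandated.
set_option linter.dupNamespace false
set_option autoImplicit false

namespace Summit.ValiantsHypothesis.ValiantsHypothesis.Theorems.KPlusLogSqLaw

open Summit.ValiantsHypothesis.ValiantsHypothesis.Theorems.MatrixDescartes.Negative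
open Finset

namespace AlternatingLineSum

variable {m K : ℕ}

/-- The weight of the `Λ`-term of `σ` is the sum of the cell scores `θ·d(Λ a b) − v a b (Λ a b)` over the cells of `σ`. [folklore] -/
theorem tropWeight_cellClass (d : Fin K → ℕ) (v : Fin m → Fin m → Fin K → ℤ) (θ : ℤ) (Λ : Fin m → Fin m → Fin K)
    (σ : Equiv.Perm (Fin m)) :
    tropWeight d v θ (σ, fun b => Λ (σ b) b) = ∑ b, (θ * (d (Λ (σ b) b) : ℤ) - v (σ b) b (Λ (σ b) b)) := by
  unfold tropWeight
  rw [Finset.sum_sub_distrib, Finset.mul_sum]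

/-- For `m ≥ 3` and any column `b` there are two further columns `c ≠ c'`, both different from `b`. [folklore] -/
theorem exists_two_ne (hm : 3 ≤ m) (b : Fin m) : ∃ c c' : Fin m, c ≠ c' ∧ c ≠ b ∧ c' ≠ b := by
  have h0 : 0 < m := by omega
  have h1 : 1 < m := by omega
  have h2 : 2 < m := by omega
  by_cases hb0 : (b : ℕ) = 0
  · exact ⟨⟨1, h1⟩, ⟨2, h2⟩, by simp [Fin.ext_iff], by simp [Fin.ext_iff]; omega, by simp [Fin.ext_iff]; omega⟩
  by_cases hb1 : (b : ℕ) = 1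
  · exact ⟨⟨0, h0⟩, ⟨2, h2⟩, by simp [Fin.ext_iff], by simp [Fin.ext_iff]; omega, by simp [Fin.ext_iff]; omega⟩
  · exact ⟨⟨0, h0⟩, ⟨1, h1⟩, by simp [Fin.ext_iff], by simp [Fin.ext_iff]; omega, by simp [Fin.ext_iff]; omega⟩

/-- The signed sum over all permutations of ONE column's cell score vanishes for `m ≥ 3`: it is the determinant of the matrix whose
column `b` is the score column and whose other columns are all ones — two of which coincide. [folklore] -/
theorem sum_sign_mul_apply_eq_zero (hm : 3 ≤ m) (g : Fin m → ℤ) (b : Fin m) :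
    ∑ σ : Equiv.Perm (Fin m), (Equiv.Perm.sign σ : ℤ) * g (σ b) = 0 := by
  classical
  obtain ⟨c, c', hcc', hcb, hc'b⟩ := exists_two_ne hm b
  let M : Matrix (Fin m) (Fin m) ℤ := fun i j => if j = b then g i else 1
  have hdet : M.det = ∑ σ : Equiv.Perm (Fin m), (Equiv.Perm.sign σ : ℤ) * g (σ b) := by
    rw [Matrix.det_apply]
    refine Finset.sum_congr rfl fun σ _ => ?_
    have hprod : ∏ i, M (σ i) i = g (σ b) := by
      have : ∏ i, M (σ i) i = ∏ i, (if i = b then g (σ i) else 1) := rfl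
      rw [this, Finset.prod_ite_eq']
      simp
    rw [hprod, Units.smul_def, smul_eq_mul]
  have hzero : M.det = 0 := by
    refine Matrix.det_zero_of_column_eq hcc' fun k => ?_
    simp [M, hcb, hc'b]
  rw [← hdet, hzero]

/-- **ALTERNATING LINE-SUM RULE** (`m ≥ 3`).  For every cell-class map `Λ` and every slope `θ`, the signed sum of the weights of the
`Λ`-terms over all permutations vanishes:  `Σ_σ sign σ · tropWeight (σ, Λ ∘ σ) = 0`.  (For `m = 3`: Σ rows = Σ columns.) [folklore] -/
theorem sum_sign_mul_tropWeight_eq_zero (hm : 3 ≤ m) (d : Fin K → ℕ) (v : Fin m → Fin m → Fin K → ℤ) (θ : ℤ)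
    (Λ : Fin m → Fin m → Fin K) :
    ∑ σ : Equiv.Perm (Fin m), (Equiv.Perm.sign σ : ℤ) * tropWeight d v θ (σ, fun b => Λ (σ b) b) = 0 := by
  simp_rw [tropWeight_cellClass, Finset.mul_sum]
  rw [Finset.sum_comm]
  refine Finset.sum_eq_zero fun b _ => ?_
  exact sum_sign_mul_apply_eq_zero hm (fun a => θ * (d (Λ a b) : ℤ) - v a b (Λ a b)) b

/-- The two sign classes carry the same total weight: for `s = ±1`,
`Σ_{sign σ = s} W σ = Σ_{sign σ = −s} W σ`. [folklore] -/
theorem sum_tropWeight_sign_eq (hm : 3 ≤ m) (d : Fin K → ℕ) (v : Fin m → Fin m → Fin K → ℤ) (θ : ℤ)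
    (Λ : Fin m → Fin m → Fin K) (s : ℤˣ) :
    ∑ σ ∈ univ.filter (fun σ : Equiv.Perm (Fin m) => Equiv.Perm.sign σ = s), tropWeight d v θ (σ, fun b => Λ (σ b) b) =
      ∑ σ ∈ univ.filter (fun σ : Equiv.Perm (Fin m) => Equiv.Perm.sign σ = -s), tropWeight d v θ (σ, fun b => Λ (σ b) b) := by
  classical
  set W : Equiv.Perm (Fin m) → ℤ := fun σ => tropWeight d v θ (σ, fun b => Λ (σ b) b) with hW
  have h0 := sum_sign_mul_tropWeight_eq_zero hm d v θ Λ
  -- split the signed sum along the two sign classes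
  have hsplit : ∑ σ : Equiv.Perm (Fin m), (Equiv.Perm.sign σ : ℤ) * W σ =
      ∑ σ ∈ univ.filter (fun σ : Equiv.Perm (Fin m) => Equiv.Perm.sign σ = s), (Equiv.Perm.sign σ : ℤ) * W σ +
      ∑ σ ∈ univ.filter (fun σ : Equiv.Perm (Fin m) => ¬ Equiv.Perm.sign σ = s), (Equiv.Perm.sign σ : ℤ) * W σ :=
    (Finset.sum_filter_add_sum_filter_not _ _ _).symm
  have hs : ∀ σ ∈ univ.filter (fun σ : Equiv.Perm (Fin m) => Equiv.Perm.sign σ = s),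
      (Equiv.Perm.sign σ : ℤ) * W σ = (s : ℤ) * W σ := by
    intro σ hσ
    rw [(Finset.mem_filter.mp hσ).2]
  have hneg : ∀ σ : Equiv.Perm (Fin m), ¬ Equiv.Perm.sign σ = s ↔ Equiv.Perm.sign σ = -s := by
    intro σ
    rcases Int.units_eq_one_or (Equiv.Perm.sign σ) with h | h <;> rcases Int.units_eq_one_or s with h' | h' <;>
      simp [h, h']
  have hns : ∀ σ ∈ univ.filter (fun σ : Equiv.Perm (Fin m) => ¬ Equiv.Perm.sign σ = s),
      (Equiv.Perm.sign σ : ℤ) * W σ = -((s : ℤ) * W σ) := by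
    intro σ hσ
    rw [(hneg σ).mp (Finset.mem_filter.mp hσ).2]
    push_cast
    ring
  rw [hsplit, Finset.sum_congr rfl hs, Finset.sum_congr rfl hns, Finset.sum_neg_distrib, ← Finset.mul_sum, ← Finset.mul_sum]
    at h0
  have hfilt : univ.filter (fun σ : Equiv.Perm (Fin m) => ¬ Equiv.Perm.sign σ = s) =
      univ.filter (fun σ : Equiv.Perm (Fin m) => Equiv.Perm.sign σ = -s) :=
    Finset.filter_congr fun σ _ => hneg σ
  rw [hfilt] at h0
  have hsu : (s : ℤ) ≠ 0 := Units.ne_zero s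
  have : (s : ℤ) * (∑ σ ∈ univ.filter (fun σ : Equiv.Perm (Fin m) => Equiv.Perm.sign σ = s), W σ -
      ∑ σ ∈ univ.filter (fun σ : Equiv.Perm (Fin m) => Equiv.Perm.sign σ = -s), W σ) = 0 := by
    rw [mul_sub]; linarith
  rcases mul_eq_zero.mp this with h | h
  · exact absurd h hsu
  · exact sub_eq_zero.mp h

/-- **HALL FORM.**  For `m ≥ 3`, a slope `θ`, a cell-class map `Λ` and ANY bijection `e` from the permutations of sign `s` to those of
sign `−s`: it is impossible that every `σ` of sign `s` strictly beats its partner `e σ`. [folklore] -/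
theorem not_forall_lt_of_signClass_equiv (hm : 3 ≤ m) (d : Fin K → ℕ) (v : Fin m → Fin m → Fin K → ℤ) (θ : ℤ)
    (Λ : Fin m → Fin m → Fin K) (s : ℤˣ)
    (e : {σ : Equiv.Perm (Fin m) // Equiv.Perm.sign σ = s} ≃ {σ : Equiv.Perm (Fin m) // Equiv.Perm.sign σ = -s}) :
    ¬ ∀ σ : {σ : Equiv.Perm (Fin m) // Equiv.Perm.sign σ = s},
        tropWeight d v θ ((e σ : Equiv.Perm (Fin m)), fun b => Λ ((e σ : Equiv.Perm (Fin m)) b) b) <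
          tropWeight d v θ ((σ : Equiv.Perm (Fin m)), fun b => Λ ((σ : Equiv.Perm (Fin m)) b) b) := by
  classical
  intro h
  set W : Equiv.Perm (Fin m) → ℤ := fun σ => tropWeight d v θ (σ, fun b => Λ (σ b) b) with hW
  have heq := sum_tropWeight_sign_eq hm d v θ Λ s
  -- rewrite both class sums as sums over the subtypes
  have h1 : ∑ σ ∈ univ.filter (fun σ : Equiv.Perm (Fin m) => Equiv.Perm.sign σ = s), W σ =
      ∑ σ : {σ : Equiv.Perm (Fin m) // Equiv.Perm.sign σ = s}, W σ := by
    rw [Finset.sum_subtype (univ.filter fun σ : Equiv.Perm (Fin m) => Equiv.Perm.sign σ = s)]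
    intro σ; simp
  have h2 : ∑ σ ∈ univ.filter (fun σ : Equiv.Perm (Fin m) => Equiv.Perm.sign σ = -s), W σ =
      ∑ σ : {σ : Equiv.Perm (Fin m) // Equiv.Perm.sign σ = -s}, W σ := by
    rw [Finset.sum_subtype (univ.filter fun σ : Equiv.Perm (Fin m) => Equiv.Perm.sign σ = -s)]
    intro σ; simp
  have h3 : ∑ τ : {σ : Equiv.Perm (Fin m) // Equiv.Perm.sign σ = -s}, W τ =
      ∑ σ : {σ : Equiv.Perm (Fin m) // Equiv.Perm.sign σ = s}, W (e σ) :=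
    (Fintype.sum_equiv e _ _ fun σ => rfl).symm
  -- a representative of the sign class `s`: the identity if `s = 1`, a transposition otherwise
  have hne : Nonempty {σ : Equiv.Perm (Fin m) // Equiv.Perm.sign σ = s} := by
    rcases Int.units_eq_one_or s with hs | hs
    · exact ⟨⟨1, by simp [hs]⟩⟩
    · have h0 : 0 < m := by omega
      have h1 : 1 < m := by omega
      refine ⟨⟨Equiv.swap (⟨0, h0⟩ : Fin m) ⟨1, h1⟩, ?_⟩⟩
      rw [hs, Equiv.Perm.sign_swap]
      simp [Fin.ext_iff]
  have hlt : ∑ σ : {σ : Equiv.Perm (Fin m) // Equiv.Perm.sign σ = s}, W (e σ) <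
      ∑ σ : {σ : Equiv.Perm (Fin m) // Equiv.Perm.sign σ = s}, W σ := by
    obtain ⟨σ₀⟩ := hne
    exact Finset.sum_lt_sum (fun σ _ => (h σ).le) ⟨σ₀, mem_univ _, h σ₀⟩
  rw [h1, h2, h3] at heq
  omega

/-- **HALL FORM, tie version.**  If every permutation of sign `s` weakly beats its partner under a bijection `e` onto the sign-`−s`
class, then every one of these comparisons is a tie. [folklore] -/
theorem eq_of_forall_le_of_signClass_equiv (hm : 3 ≤ m) (d : Fin K → ℕ) (v : Fin m → Fin m → Fin K → ℤ) (θ : ℤ)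
    (Λ : Fin m → Fin m → Fin K) (s : ℤˣ)
    (e : {σ : Equiv.Perm (Fin m) // Equiv.Perm.sign σ = s} ≃ {σ : Equiv.Perm (Fin m) // Equiv.Perm.sign σ = -s})
    (h : ∀ σ : {σ : Equiv.Perm (Fin m) // Equiv.Perm.sign σ = s},
        tropWeight d v θ ((e σ : Equiv.Perm (Fin m)), fun b => Λ ((e σ : Equiv.Perm (Fin m)) b) b) ≤
          tropWeight d v θ ((σ : Equiv.Perm (Fin m)), fun b => Λ ((σ : Equiv.Perm (Fin m)) b) b))
    (σ : {σ : Equiv.Perm (Fin m) // Equiv.Perm.sign σ = s}) :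
    tropWeight d v θ ((e σ : Equiv.Perm (Fin m)), fun b => Λ ((e σ : Equiv.Perm (Fin m)) b) b) =
      tropWeight d v θ ((σ : Equiv.Perm (Fin m)), fun b => Λ ((σ : Equiv.Perm (Fin m)) b) b) := by
  classical
  set W : Equiv.Perm (Fin m) → ℤ := fun σ => tropWeight d v θ (σ, fun b => Λ (σ b) b) with hW
  have heq := sum_tropWeight_sign_eq hm d v θ Λ s
  have h1 : ∑ σ ∈ univ.filter (fun σ : Equiv.Perm (Fin m) => Equiv.Perm.sign σ = s), W σ =
      ∑ σ : {σ : Equiv.Perm (Fin m) // Equiv.Perm.sign σ = s}, W σ := by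
    rw [Finset.sum_subtype (univ.filter fun σ : Equiv.Perm (Fin m) => Equiv.Perm.sign σ = s)]
    intro σ; simp
  have h2 : ∑ σ ∈ univ.filter (fun σ : Equiv.Perm (Fin m) => Equiv.Perm.sign σ = -s), W σ =
      ∑ σ : {σ : Equiv.Perm (Fin m) // Equiv.Perm.sign σ = -s}, W σ := by
    rw [Finset.sum_subtype (univ.filter fun σ : Equiv.Perm (Fin m) => Equiv.Perm.sign σ = -s)]
    intro σ; simp
  have h3 : ∑ τ : {σ : Equiv.Perm (Fin m) // Equiv.Perm.sign σ = -s}, W τ =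
      ∑ σ : {σ : Equiv.Perm (Fin m) // Equiv.Perm.sign σ = s}, W (e σ) :=
    (Fintype.sum_equiv e _ _ fun σ => rfl).symm
  rw [h1, h2, h3] at heq
  -- a sum of non-negative differences vanishes, so each difference vanishes
  have hsum : ∑ τ : {σ : Equiv.Perm (Fin m) // Equiv.Perm.sign σ = s}, (W τ - W (e τ)) = 0 := by
    rw [Finset.sum_sub_distrib]; omega
  have hnn : ∀ τ ∈ (univ : Finset {σ : Equiv.Perm (Fin m) // Equiv.Perm.sign σ = s}), 0 ≤ W τ - W (e τ) :=
    fun τ _ => sub_nonneg.mpr (h τ)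
  have := (Finset.sum_eq_zero_iff_of_nonneg hnn).mp hsum σ (mem_univ _)
  exact (sub_eq_zero.mp this).symm

/-- **AT A DOMINANT TERM.**  Let `(σ₀, μ₀)` be the unique optimum at `θ` (`m ≥ 3`), let the cell-class map `Λ` agree with `μ₀` on the
cells of `σ₀`, and suppose the `Λ`-terms of the permutations of the opposite sign are present.  Then for every bijection `e` from
`σ₀`'s sign class onto the opposite class some `σ ≠ σ₀` of `σ₀`'s own class does not beat its partner: `W σ ≤ W (e σ)`.
(`m = 3`: when a row is on top, for every pairing of the two other rows with two of the columns one of them loses.) [folklore] -/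
theorem exists_ne_le_partner_of_isDominant (hm : 3 ≤ m) (d : Fin K → ℕ) (v ε : Fin m → Fin m → Fin K → ℤ) (θ : ℤ)
    (Λ : Fin m → Fin m → Fin K) (σ₀ : Equiv.Perm (Fin m)) (μ₀ : Fin m → Fin K)
    (hΛ : ∀ b, Λ (σ₀ b) b = μ₀ b) (hdom : IsDominant d v ε θ (σ₀, μ₀))
    (hpres : ∀ τ : Equiv.Perm (Fin m), Equiv.Perm.sign τ = -Equiv.Perm.sign σ₀ →
      termSign ε (τ, fun b => Λ (τ b) b) ≠ 0)
    (e : {σ : Equiv.Perm (Fin m) // Equiv.Perm.sign σ = Equiv.Perm.sign σ₀} ≃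
      {σ : Equiv.Perm (Fin m) // Equiv.Perm.sign σ = -Equiv.Perm.sign σ₀}) :
    ∃ σ : {σ : Equiv.Perm (Fin m) // Equiv.Perm.sign σ = Equiv.Perm.sign σ₀}, (σ : Equiv.Perm (Fin m)) ≠ σ₀ ∧
      tropWeight d v θ ((σ : Equiv.Perm (Fin m)), fun b => Λ ((σ : Equiv.Perm (Fin m)) b) b) ≤
        tropWeight d v θ ((e σ : Equiv.Perm (Fin m)), fun b => Λ ((e σ : Equiv.Perm (Fin m)) b) b) := by
  classical
  by_contra hcon
  push Not at hcon
  apply not_forall_lt_of_signClass_equiv hm d v θ Λ (Equiv.Perm.sign σ₀) e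
  intro σ
  by_cases hσ : (σ : Equiv.Perm (Fin m)) = σ₀
  · -- the partner of `σ₀` is another permutation, present, hence strictly below the dominant term
    have hτsign : Equiv.Perm.sign (e σ : Equiv.Perm (Fin m)) = -Equiv.Perm.sign σ₀ := (e σ).2
    have hτne : ((e σ : Equiv.Perm (Fin m)), fun b => Λ ((e σ : Equiv.Perm (Fin m)) b) b) ≠ (σ₀, μ₀) := by
      intro h
      have h1 : (e σ : Equiv.Perm (Fin m)) = σ₀ := congrArg Prod.fst h
      rw [h1] at hτsign
      rcases Int.units_eq_one_or (Equiv.Perm.sign σ₀) with h2 | h2 <;> rw [h2] at hτsign <;> exact absurd hτsign (by decide)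
    have hlt := hdom.2 _ hτne (hpres _ hτsign)
    have hσ₀ : tropWeight d v θ (σ₀, μ₀) =
        tropWeight d v θ ((σ : Equiv.Perm (Fin m)), fun b => Λ ((σ : Equiv.Perm (Fin m)) b) b) := by
      have hμ : μ₀ = fun b => Λ (σ₀ b) b := funext fun b => (hΛ b).symm
      rw [hσ, hμ]
    rw [← hσ₀]
    exact hlt
  · exact hcon σ hσ


/-! ## Appendix (val-sym-trop-p3 g7, same day): the TIME-SPREAD Hall form («SUM RULE + PERSISTENCE», axiom (iv) of the lineage's
three-axiom model of the `m = 3` row, now for every `m ≥ 3`).  Dominations `W σ > W (e σ)` observed at DIFFERENT slopes `θ_σ` transport to a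
common slope `θ⋆` by linearity — forward when the winner's term is at least as steep, backward when it is at most as steep — and at `θ⋆` the
Hall form forbids them.  This is the shape of every LP infeasibility core met when a ninth-cell line is inserted into the engine-plus-singles
schedules of the `m = 3` row (memo FINDINGS-val-sym-trop-p3-g7.md §2(c)): three dominant terms of the three even lines beating their partners
under a bijection onto the odd lines. -/

/-- Linearity of weight differences in the slope: `(W_θ' p − W_θ' q) = (W_θ p − W_θ q) + (θ' − θ)·(S p − S q)` with `S` the exponent sum. [folklore] -/
theorem tropWeight_sub_transport (d : Fin K → ℕ) (v : Fin m → Fin m → Fin K → ℤ) (θ θ' : ℤ)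
    (p q : Equiv.Perm (Fin m) × (Fin m → Fin K)) :
    tropWeight d v θ' p - tropWeight d v θ' q =
      tropWeight d v θ p - tropWeight d v θ q + (θ' - θ) * (∑ i, (d (p.2 i) : ℤ) - ∑ i, (d (q.2 i) : ℤ)) := by
  unfold tropWeight; ring

/-- **TIME-SPREAD HALL FORM (sum rule + persistence).**  `m ≥ 3`, a cell-class map `Λ`, a bijection `e` from the sign-`s` permutations onto the
sign-`−s` ones, a slope `θ_σ` for every `σ` of sign `s` and a common slope `θ⋆`.  If every `σ` strictly beats its partner at ITS OWN slope,
`W_{θ_σ} (e σ) < W_{θ_σ} σ`, and each of these dominations transports to `θ⋆` — either `θ_σ ≤ θ⋆` and `σ`'s `Λ`-term is at least as steep as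
`e σ`'s, or `θ⋆ ≤ θ_σ` and it is at most as steep — then we have a contradiction.  (At `θ⋆` all dominations hold at once, against
`not_forall_lt_of_signClass_equiv`.) [folklore] -/
theorem false_of_transported_dominations (hm : 3 ≤ m) (d : Fin K → ℕ) (v : Fin m → Fin m → Fin K → ℤ)
    (Λ : Fin m → Fin m → Fin K) (s : ℤˣ)
    (e : {σ : Equiv.Perm (Fin m) // Equiv.Perm.sign σ = s} ≃ {σ : Equiv.Perm (Fin m) // Equiv.Perm.sign σ = -s})
    (θ : {σ : Equiv.Perm (Fin m) // Equiv.Perm.sign σ = s} → ℤ) (θs : ℤ)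
    (hbeat : ∀ σ : {σ : Equiv.Perm (Fin m) // Equiv.Perm.sign σ = s},
        tropWeight d v (θ σ) ((e σ : Equiv.Perm (Fin m)), fun b => Λ ((e σ : Equiv.Perm (Fin m)) b) b) <
          tropWeight d v (θ σ) ((σ : Equiv.Perm (Fin m)), fun b => Λ ((σ : Equiv.Perm (Fin m)) b) b))
    (htrans : ∀ σ : {σ : Equiv.Perm (Fin m) // Equiv.Perm.sign σ = s},
        (θ σ ≤ θs ∧ ∑ i, (d (Λ ((e σ : Equiv.Perm (Fin m)) i) i) : ℤ) ≤ ∑ i, (d (Λ ((σ : Equiv.Perm (Fin m)) i) i) : ℤ)) ∨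
        (θs ≤ θ σ ∧ ∑ i, (d (Λ ((σ : Equiv.Perm (Fin m)) i) i) : ℤ) ≤ ∑ i, (d (Λ ((e σ : Equiv.Perm (Fin m)) i) i) : ℤ))) :
    False := by
  apply not_forall_lt_of_signClass_equiv hm d v θs Λ s e
  intro σ
  have h := tropWeight_sub_transport d v (θ σ) θs
    ((σ : Equiv.Perm (Fin m)), fun b => Λ ((σ : Equiv.Perm (Fin m)) b) b)
    ((e σ : Equiv.Perm (Fin m)), fun b => Λ ((e σ : Equiv.Perm (Fin m)) b) b)
  have hb := hbeat σ
  rcases htrans σ with ⟨h1, h2⟩ | ⟨h1, h2⟩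
  · have : 0 ≤ (θs - θ σ) * (∑ i, (d (Λ ((σ : Equiv.Perm (Fin m)) i) i) : ℤ) -
        ∑ i, (d (Λ ((e σ : Equiv.Perm (Fin m)) i) i) : ℤ)) := mul_nonneg (by linarith) (by linarith)
    simp only at h
    linarith
  · have : 0 ≤ (θs - θ σ) * (∑ i, (d (Λ ((σ : Equiv.Perm (Fin m)) i) i) : ℤ) -
        ∑ i, (d (Λ ((e σ : Equiv.Perm (Fin m)) i) i) : ℤ)) :=
      mul_nonneg_of_nonpos_of_nonpos (by linarith) (by linarith)
    simp only at h
    linarith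

/-- **The same at dominant terms.**  If for every `σ` of sign `s` the `Λ`-term of `σ` is the unique optimum at `θ_σ` (with `Λ` read on its own
cells) and the partner terms are present, the transport hypothesis alone is contradictory: a family of dominant terms, one per permutation of a
sign class, whose dominations over a perfect matching of partners persist to a common slope, does not exist. [folklore] -/
theorem false_of_dominant_family (hm : 3 ≤ m) (d : Fin K → ℕ) (v ε : Fin m → Fin m → Fin K → ℤ)
    (Λ : Fin m → Fin m → Fin K) (s : ℤˣ)
    (e : {σ : Equiv.Perm (Fin m) // Equiv.Perm.sign σ = s} ≃ {σ : Equiv.Perm (Fin m) // Equiv.Perm.sign σ = -s})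
    (θ : {σ : Equiv.Perm (Fin m) // Equiv.Perm.sign σ = s} → ℤ) (θs : ℤ)
    (hdom : ∀ σ : {σ : Equiv.Perm (Fin m) // Equiv.Perm.sign σ = s},
        IsDominant d v ε (θ σ) ((σ : Equiv.Perm (Fin m)), fun b => Λ ((σ : Equiv.Perm (Fin m)) b) b))
    (hpres : ∀ σ : {σ : Equiv.Perm (Fin m) // Equiv.Perm.sign σ = s},
        termSign ε ((e σ : Equiv.Perm (Fin m)), fun b => Λ ((e σ : Equiv.Perm (Fin m)) b) b) ≠ 0)
    (htrans : ∀ σ : {σ : Equiv.Perm (Fin m) // Equiv.Perm.sign σ = s},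
        (θ σ ≤ θs ∧ ∑ i, (d (Λ ((e σ : Equiv.Perm (Fin m)) i) i) : ℤ) ≤ ∑ i, (d (Λ ((σ : Equiv.Perm (Fin m)) i) i) : ℤ)) ∨
        (θs ≤ θ σ ∧ ∑ i, (d (Λ ((σ : Equiv.Perm (Fin m)) i) i) : ℤ) ≤ ∑ i, (d (Λ ((e σ : Equiv.Perm (Fin m)) i) i) : ℤ))) :
    False := by
  refine false_of_transported_dominations hm d v Λ s e θ θs (fun σ => ?_) htrans
  refine (hdom σ).2 _ ?_ (hpres σ)
  intro h
  have h1 : (e σ : Equiv.Perm (Fin m)) = (σ : Equiv.Perm (Fin m)) := congrArg Prod.fst h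
  have h2 : Equiv.Perm.sign (e σ : Equiv.Perm (Fin m)) = -s := (e σ).2
  rw [h1, σ.2] at h2
  rcases Int.units_eq_one_or s with h3 | h3 <;> rw [h3] at h2 <;> exact absurd h2 (by decide)


/-! ## Appendix 2 (val-sym-trop-p3 g7): the `m = 3` dictionary.  The even permutations of `Fin 3` are the three ROTATIONS `b ↦ b + i`
(the lineage's «rows» `R_i = {(b+i, b)}`), the odd ones the three ANTI-ROTATIONS `b ↦ j − b` («columns» `C_j = {(j−b, b)}`); every cell lies
on exactly one of each, and the rule reads `Σ_i W(R_i) = Σ_j W(C_j)` (g6's `ΣR_i = ΣC_j`). -/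

/-- The even permutations of `Fin 3` are the rotations `Equiv.addRight i`. [folklore] -/
theorem three_filter_sign_one :
    (univ.filter fun σ : Equiv.Perm (Fin 3) => Equiv.Perm.sign σ = 1) =
      (univ : Finset (Fin 3)).image (fun i : Fin 3 => (Equiv.addRight i : Equiv.Perm (Fin 3))) := by
  decide

/-- The odd permutations of `Fin 3` are the anti-rotations `Equiv.subLeft j : b ↦ j − b`. [folklore] -/
theorem three_filter_sign_neg_one :
    (univ.filter fun σ : Equiv.Perm (Fin 3) => Equiv.Perm.sign σ = -1) =
      (univ : Finset (Fin 3)).image (fun j : Fin 3 => (Equiv.subLeft j : Equiv.Perm (Fin 3))) := by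
  decide

/-- **SUM RULE for `3 × 3` designs, row/column form.**  For every cell-class map `Λ` and slope `θ`:
`Σ_i W(rotation i) = Σ_j W(anti-rotation j)`, i.e. `R₀ + R₁ + R₂ = C₀ + C₁ + C₂` for the `Λ`-terms. [folklore] -/
theorem three_sum_rows_eq_sum_cols {K : ℕ} (d : Fin K → ℕ) (v : Fin 3 → Fin 3 → Fin K → ℤ) (θ : ℤ) (Λ : Fin 3 → Fin 3 → Fin K) :
    ∑ i : Fin 3, tropWeight d v θ ((Equiv.addRight i : Equiv.Perm (Fin 3)), fun b => Λ ((Equiv.addRight i : Equiv.Perm (Fin 3)) b) b) =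
      ∑ j : Fin 3, tropWeight d v θ ((Equiv.subLeft j : Equiv.Perm (Fin 3)), fun b => Λ ((Equiv.subLeft j : Equiv.Perm (Fin 3)) b) b) := by
  have h := sum_tropWeight_sign_eq (le_refl 3) d v θ Λ 1
  rw [three_filter_sign_one, three_filter_sign_neg_one] at h
  rw [Finset.sum_image (fun i _ i' _ hii' => by
        have := congrArg (fun e : Equiv.Perm (Fin 3) => e 0) hii'
        simpa using this),
      Finset.sum_image (fun j _ j' _ hjj' => by
        have := congrArg (fun e : Equiv.Perm (Fin 3) => e 0) hjj'
        simpa using this)] at h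
  exact h

end AlternatingLineSum

end Summit.ValiantsHypothesis.ValiantsHypothesis.Theorems.KPlusLogSqLaw
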